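/-
Origin: expansion seat `prover-pub-hodgecm-own-htheta-0`, handover #H7 2026-08-21T05:23Z md5 aad695490c6b (306 l.; NEW additive KERNEL leaf beside E; imports LANDED binder-2 #100 `HodgeCM.Model.HsmallOfTowerAtLineTypeEq` (RUN 68) ONLY — no RUN-72 dependency, drop alone; ns HodgeCM.Model; 8 theorems 0 defs 0 records 0 `def … : Prop`: THE SINGLE-BLOCK JUNCTION SOCKETS — `subset_span_of_block` (dictionary level: classes whose K-fixed tower lift lies in ONE block `block μ` lie below r8's threshold in the span of the common-reflex surface classes, from `T.Thm418C` ALONE — axioms-1's `subset_span_of_liuDictionary` with S := {μ} and NO Prop-4.13 decomposition, so `Irreducible ∕ Prop413 ∕ Thm418_2 ∕ MuSeparated` are not hypotheses) → `_of_below` → `subset_span_of_tower_block` → `hsmall_of_tower_at_block` (binder-1 #R120 shape, Riemann `hR`) → `_of_typeOf ∕ _of_lineType_eq ∕ _of_isometric` (binder-2 #92 ∕ #100 shapes) → `hsmall_of_weilFamilyAut_at_block_of_isometric` (axioms-1's indexed instance of record); NAMES for audit: HodgeCM.Model.subset_span_of_block · HodgeCM.Model.hsmall_of_tower_at_block ·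 HodgeCM.Model.hsmall_of_weilFamilyAut_at_block_of_isometric) (`HOME/pub-hodgecm-own-htheta/stage73/HodgeCM/Model/HsmallOfBlockAt.lean`, md5 aad695490c6b, 306 lines);
landed by the gen-31 packager (p-g31) in gate run 73 as `HodgeCM/Model/HsmallOfBlockAt.lean` (verbatim).
-/
/-
Copyright (c) 2026 the pub-hodgecm formalisation cell (harness21).  New file, not vendored.
Origin: ROW-9 OWNER seat `prover-pub-hodgecm-own-htheta-0` (unit pub-hodgecm-own-htheta, named single owner of the (J-Liu-Θ) junction
theorem ∕ binder row 9 `hΘ`), 2026-08-21.  Target in PKG: `HodgeCM/Model/HsmallOfBlockAt.lean` (NEW additive KERNEL leaf beside E;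
imports binder-2's landed #100 `HodgeCM.Model.HsmallOfTowerAtLineTypeEq` (RUN 68) only; nothing imports it; outside E's import closure;
E untouched; MODEL-N ±0).  KERNEL ONLY: theorems; 0 defs, 0 records, nothing cited, 0 `def … : Prop`.
Nothing here is a claim of the manuscripts under adjudication.
-/
import Summits.HodgeConjecture.HodgeCM.Model.HsmallOfTowerAtLineTypeEq

set_option autoImplicit false

/-!
# (J3) E's `hsmall` at a point FROM ONE BLOCK — the junction on `Thm418C` ALONE

The landed junction lemma `subset_span_of_liuDictionary` (axioms-1, `Model/LiuDictionary.lean`) and every socket above it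
(`subset_span_of_tower`, binder-1 #R120 `hsmall_of_tower_at`, binder-2 #92–#100, axioms-1 #6r2, #102 `hsmall_of_pin_at_of_isometric`)
take the FIVE dictionary sentences `Irreducible ∧ Prop413 ∧ Thm418_2 ∧ MuSeparated ∧ Thm418C`, because their `hIso` clause places the
`K`-fixed tower vector `x` of a theta class in a SUM of blocks `⨆ μ ∈ S, block μ` over a finite set `S` of characters: the first four
sentences serve ONLY to project `x` onto `ℂ[G]`-equivariant, hence `K`-fixed, components in the single blocks (Prop. 4.13's decomposition
+ Schur separation), after which the combined reading `Thm418C` (r8) is applied block by block.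

At the pin of record the sum is NOT NEEDED: binder-2's pin-generic slot theorems (`Binders/JLiuSlots01 ∕ 23`, RUN 72) put every theta class
of slot `k` in the block of ONE index — `T := {j}`, `j` THE index of the twisted slot record (theta-3 #S19) — and `Thm418C` is stated
on `block μ ∩ H^K` directly.  This leaf is the single-block junction: the same sockets with
* `hIso ∕ hfam` placing `x` in ONE block `block μ`, and
* the dictionary hypothesis reduced to **`Thm418C` alone** — `Irreducible`, `Prop413`, `Thm418_2` and the displayed model hypothesis
  `MuSeparated` (CF07: «NOT A PRINTED SENTENCE») are not consumed.
Chain (each a few lines over the landed tails): `subset_span_of_block` (dictionary level) → `subset_span_of_block_of_below` →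
`subset_span_of_tower_block` (`LiuDictionary.ofTower`, component families) → `hsmall_of_tower_at_block` (E's `hsmall` at `(V, c, i)`,
Riemann `hR`) → `hsmall_of_tower_at_block_of_typeOf` ((J4a)+(J5) read off a type map) → `hsmall_of_tower_at_block_of_lineType_eq` ∕
`hsmall_of_tower_at_block_of_isometric` (slot clause a type equation ∕ an isometry) → `hsmall_of_weilFamilyAut_at_block_of_isometric`
(axioms-1's indexed instance of record).  All `[folklore]`; nothing cited (the one sentence is the hypothesis `h418`).
-/

noncomputable section

open Function Set
open NumberField
open Literature.AlgebraicGeometry.Motives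
open Literature.AlgebraicGeometry.ShimuraVarieties
open Literature.AlgebraicGeometry.HodgeTheory
open Literature.NumberTheory.Automorphic
open Literature.NumberTheory.Automorphic.PicardCM
open Literature.NumberTheory.Transcendental (Arapura2012_Cor_15_4_6)

namespace HodgeCM.Model

open HodgeCM.Model.TowerLevel HodgeCM.Model.TowerCarrier HodgeCM.Literature.Theta HodgeCM.Literature.Theta.LiuAlbaneseModuleDatum
open HodgeCM.CMTypeOps (inflate inflate_id)
open HodgeCM.Universe (ThetaModel)
open HodgeCM.SignRecipe (lineType liftType)

/-! ## §1 Dictionary level: the classes of ONE block, from `Thm418C` alone -/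

section Dictionary

variable {hHD : exists_isReal_hodgeModel} {hI : hodgePQ_independent_of_hodgeModel}
  {h₁ : BallQuotientUniformised} {h₃ : CMAbelianVarietyRealised}
variable {L : CMField} {ι₁ : L →+* ℂ} {V : HermSpace3 L ι₁} (T : LiuDictionary hHD hI h₁ h₃ V)

/-- **ROW 9 FROM ONE BLOCK.**  If the combined reading `Thm418C` holds for the dictionary `T`, `μ` is a character with `ι₁ ∈ Φ_μ` whose
admissible CM records match the corner `(K, Ψ, σ)`, and every class of `Θ Γ` is the identity-component restriction of a `Γ.K`-fixed
vector of the ONE block `block μ`, then below the threshold of r8 at `μ` the classes lie in the span of the common-reflex surface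
classes.  (`subset_span_of_liuDictionary` with `S := {μ}` and NO decomposition: `Irreducible ∕ Prop413 ∕ Thm418_2 ∕ MuSeparated` unused.)
[folklore] -/
theorem subset_span_of_block (h418 : T.Thm418C)
    {K : CMField} {Ψ : CMType K} {σ : K →+* ℂ} (μ : T.Char) (hΦ : T.PhiMu μ)
    (hcorner : ∀ d : LiuCMSide, T.adm μ d → d.IsCorner K Ψ σ)
    (Θ : ∀ Γ : Level V, Set ((picardCMUniverse hHD hI h₁ h₃).CohC ((picardCMUniverse hHD hI h₁ h₃).pms L ι₁ V Γ) 1))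
    (hIso : ∀ (Γ : Level V), ∀ ω ∈ Θ Γ, ∃ x : T.H, x ∈ fixedBy Γ.K T.H ∧ T.res Γ x = ω ∧ x ∈ T.block μ) :
    ∃ Γ₀ : Level V, ∀ Γ ≤ Γ₀,
      Θ Γ ⊆ Submodule.span ℂ (⋃ D : CommonReflexInput K Ψ σ, D.surfaceClasses hHD hI h₁ h₃ V Γ) := by
  obtain ⟨K₀, hK₀⟩ := h418 μ hΦ
  refine ⟨K₀, fun Γ hΓ ω hω => ?_⟩
  obtain ⟨x, hxfix, hxres, hxbl⟩ := hIso Γ ω hω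
  rw [← hxres]
  refine Submodule.span_mono ?_ (hK₀ Γ hΓ x hxbl hxfix)
  intro y hy
  simp only [LiuDictionary.cmClasses, Set.mem_iUnion, Set.mem_range] at hy
  obtain ⟨d, hd, f, rfl⟩ := hy
  obtain ⟨D, -, hD⟩ := d.exists_commonReflexInput_of_isCorner hHD hI h₁ h₃ (hcorner d hd) V
  exact Set.mem_iUnion.2 ⟨D, hD Γ f⟩

/-- the same with `hIso` asked only at levels below a conjugate of `K_f(3)` (the threshold is cut down to `Level.three`). [folklore] -/
theorem subset_span_of_block_of_below (h418 : T.Thm418C)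
    {K : CMField} {Ψ : CMType K} {σ : K →+* ℂ} (μ : T.Char) (hΦ : T.PhiMu μ)
    (hcorner : ∀ d : LiuCMSide, T.adm μ d → d.IsCorner K Ψ σ)
    (Θ : ∀ Γ : Level V, Set ((picardCMUniverse hHD hI h₁ h₃).CohC ((picardCMUniverse hHD hI h₁ h₃).pms L ι₁ V Γ) 1))
    (hIso : ∀ (Γ : Level V), Γ.BelowConjThree → ∀ ω ∈ Θ Γ, ∃ x : T.H,
      x ∈ fixedBy Γ.K T.H ∧ T.res Γ x = ω ∧ x ∈ T.block μ) :
    ∃ Γ₀ : Level V, ∀ Γ ≤ Γ₀,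
      Θ Γ ⊆ Submodule.span ℂ (⋃ D : CommonReflexInput K Ψ σ, D.surfaceClasses hHD hI h₁ h₃ V Γ) := by
  classical
  let Θ' : ∀ Γ : Level V, Set ((picardCMUniverse hHD hI h₁ h₃).CohC ((picardCMUniverse hHD hI h₁ h₃).pms L ι₁ V Γ) 1) :=
    fun Γ ↦ if Γ.BelowConjThree then Θ Γ else ∅
  have hIso' : ∀ (Γ : Level V), ∀ ω ∈ Θ' Γ, ∃ x : T.H, x ∈ fixedBy Γ.K T.H ∧ T.res Γ x = ω ∧ x ∈ T.block μ := by
    intro Γ ω hω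
    by_cases hΓ : Γ.BelowConjThree
    · have hω' : ω ∈ Θ Γ := by simpa only [Θ', if_pos hΓ] using hω
      exact hIso Γ hΓ ω hω'
    · simp only [Θ', if_neg hΓ, Set.mem_empty_iff_false] at hω
  obtain ⟨Γ₀, hΓ₀⟩ := subset_span_of_block T h418 μ hΦ hcorner Θ' hIso'
  refine ⟨Γ₀ ⊓ Level.three V, fun Γ hΓ ω hω ↦ ?_⟩
  have hb : Γ.BelowConjThree := Level.belowConjThree_of_le_three (hΓ.trans inf_le_right)
  have hω' : ω ∈ Θ' Γ := by simpa only [Θ', if_pos hb] using hω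
  exact hΓ₀ Γ (hΓ.trans inf_le_left) hω'

end Dictionary

/-! ## §2 Through the tower (`LiuDictionary.ofTower`): component families, then E's `hsmall` at a point -/

section Tower

variable (hHD : exists_isReal_hodgeModel) (hI : hodgePQ_independent_of_hodgeModel)
  (h₁ : BallQuotientUniformised) (h₃ : CMAbelianVarietyRealised)
variable {L : CMField} {ι₁ : L →+* ℂ} (V : HermSpace3 L ι₁)

/-- **ROW 9 THROUGH THE TOWER, ONE BLOCK**: `subset_span_of_tower` with the component families landing in `block μ` and `Thm418C` alone. [folklore] -/
theorem subset_span_of_tower_block (hA : Arapura2012_Cor_15_4_6)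
    (Char : Type) (Adm : Char → Type) (Ω : (μ : Char) → Adm μ → Type)
    [∀ μ a, AddCommGroup (Ω μ a)] [∀ μ a, Module ℂ (Ω μ a)] [∀ μ a, Module (adelicAlgebra V) (Ω μ a)]
    [∀ μ a, IsScalarTower ℂ (adelicAlgebra V) (Ω μ a)] (PhiMu : Char → Prop) (adm : Char → LiuCMSide → Prop)
    (h418 : (LiuDictionary.ofTower hHD hI h₁ h₃ hA V Char Adm Ω PhiMu adm).Thm418C)
    {K : CMField} {Ψ : CMType K} {σ : K →+* ℂ}
    (μ : Char) (hΦ : PhiMu μ) (hcorner : ∀ d : LiuCMSide, adm μ d → d.IsCorner K Ψ σ)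
    (Θ : ∀ Γ : Level V, Set ((picardCMUniverse hHD hI h₁ h₃).CohC ((picardCMUniverse hHD hI h₁ h₃).pms L ι₁ V Γ) 1))
    (hfam : ∀ (Γ : Level V) (hΓ : Γ.BelowConjThree), ∀ ω ∈ Θ Γ,
      ∃ c : towerLevel hHD hI (ballQuotientUniformisedDatum_of h₁) h₃ hA Γ hΓ,
        TowerLevel.res hHD hI (ballQuotientUniformisedDatum_of h₁) h₃ hA c = ω ∧
          (ofLevel hHD hI (ballQuotientUniformisedDatum_of h₁) h₃ hA Γ hΓ c :
              (LiuDictionary.ofTower hHD hI h₁ h₃ hA V Char Adm Ω PhiMu adm).H) ∈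
            (LiuDictionary.ofTower hHD hI h₁ h₃ hA V Char Adm Ω PhiMu adm).block μ) :
    ∃ Γ₀ : Level V, ∀ Γ ≤ Γ₀,
      Θ Γ ⊆ Submodule.span ℂ (⋃ D : CommonReflexInput K Ψ σ, D.surfaceClasses hHD hI h₁ h₃ V Γ) :=
  subset_span_of_block_of_below (LiuDictionary.ofTower hHD hI h₁ h₃ hA V Char Adm Ω PhiMu adm) h418 μ hΦ hcorner Θ
    fun Γ hΓ ω hω ↦ by
      obtain ⟨c, hc, hblock⟩ := hfam Γ hΓ ω hω
      exact LiuDictionary.hIso_of_towerLevel hHD hI h₁ h₃ hA Char Adm Ω PhiMu adm hΓ c hc _ hblock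

/-- **E's `hsmall` AT `(V, c, i)` FROM ONE BLOCK** (binder-1 #R120 `hsmall_of_tower_at` with `hJ := ∃ μ, …` a SINGLE character and
`hcite := Thm418C` alone; Riemann's theorem `hR` turns the span statement into `Uiso`). [folklore] -/
theorem hsmall_of_tower_at_block (hR : DeligneMilne1982_Thm_6_20_full) (hA : Arapura2012_Cor_15_4_6)
    (R : (picardCMUniverse hHD hI h₁ h₃).ThetaModel) (c : SeesawCtx L)
    (Char : Type) (Adm : Char → Type) (Ω : (μ : Char) → Adm μ → Type)
    [∀ μ a, AddCommGroup (Ω μ a)] [∀ μ a, Module ℂ (Ω μ a)] [∀ μ a, Module (adelicAlgebra V) (Ω μ a)]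
    [∀ μ a, IsScalarTower ℂ (adelicAlgebra V) (Ω μ a)] (PhiMu : Char → Prop) (adm : Char → LiuCMSide → Prop)
    (h418 : (LiuDictionary.ofTower hHD hI h₁ h₃ hA V Char Adm Ω PhiMu adm).Thm418C)
    (hgood : R.GoodCtx ι₁ c) (i : Fin 4)
    (hJ : ∃ μ : Char,
        PhiMu μ ∧ (∀ d : LiuCMSide, adm μ d → d.IsCorner c.K (c.Ψ i) c.σ) ∧
        ∀ (Γ : Level V) (hΓ : Γ.BelowConjThree), ∀ ω ∈ R.Theta V c i Γ,
          ∃ cf : towerLevel hHD hI (ballQuotientUniformisedDatum_of h₁) h₃ hA Γ hΓ,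
            TowerLevel.res hHD hI (ballQuotientUniformisedDatum_of h₁) h₃ hA cf = ω ∧
              (ofLevel hHD hI (ballQuotientUniformisedDatum_of h₁) h₃ hA Γ hΓ cf :
                  (LiuDictionary.ofTower hHD hI h₁ h₃ hA V Char Adm Ω PhiMu adm).H) ∈
                (LiuDictionary.ofTower hHD hI h₁ h₃ hA V Char Adm Ω PhiMu adm).block μ) :
    ∃ Γ₀ : Level V, ∀ Γ ≤ Γ₀,
      ∃ (M : CMField) (k : c.K →+* M) (σ' : M →+* ℂ), σ'.comp k = c.σ ∧
        R.Theta V c i Γ ⊆ (picardCMUniverse hHD hI h₁ h₃).Uiso Γ M (inflate k (c.Ψ i)) σ' := by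
  obtain ⟨μ, hΦ, hcorner, hfam⟩ := hJ
  obtain ⟨Γ₀, hΓ₀⟩ := subset_span_of_tower_block hHD hI h₁ h₃ V hA Char Adm Ω PhiMu adm h418 μ hΦ hcorner
    (fun Γ ↦ R.Theta V c i Γ) hfam
  refine ⟨Γ₀, fun Γ hΓ ↦ ⟨c.K, RingHom.id _, c.σ, RingHom.comp_id _, ?_⟩⟩
  rw [inflate_id]
  exact fun x hx ↦ span_iUnion_surfaceClasses_le_Uiso hHD hI h₁ h₃ hR V Γ (hgood.mem i) (hΓ₀ Γ hΓ hx)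

/-- **… with `PhiMu ∕ adm` READ OFF a type map `typeOf` and clauses 1–2 from (J4a)** (binder-2 #92 `hsmall_of_tower_at_of_typeOf`, one block). [folklore] -/
theorem hsmall_of_tower_at_block_of_typeOf (hR : DeligneMilne1982_Thm_6_20_full) (hA : Arapura2012_Cor_15_4_6)
    (R : (picardCMUniverse hHD hI h₁ h₃).ThetaModel) (c : SeesawCtx L)
    (Char : Type) (Adm : Char → Type) (Ω : (μ : Char) → Adm μ → Type)
    [∀ μ a, AddCommGroup (Ω μ a)] [∀ μ a, Module ℂ (Ω μ a)] [∀ μ a, Module (adelicAlgebra V) (Ω μ a)]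
    [∀ μ a, IsScalarTower ℂ (adelicAlgebra V) (Ω μ a)] (typeOf : Char → CMType L)
    (h418 : (LiuDictionary.ofTower hHD hI h₁ h₃ hA V Char Adm Ω (fun μ => ι₁ ∈ (typeOf μ).1)
        (fun μ d => d.IsReflexOfTypeG ι₁ (typeOf μ))).Thm418C)
    (hgood : R.GoodCtx ι₁ c)
    (h6 : Module.finrank ℚ c.K = 6 ∧ IsNormalClosure ℚ c.K L ∧ (Module.finrank ℚ L = 24 ∨ Module.finrank ℚ L = 48))
    (i : Fin 4)
    (hJ4 : ∃ μ : Char,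
        (∃ j : c.K →+* L, ι₁.comp j = c.σ ∧ typeOf μ = liftType false c.K L j ι₁ (c.Ψ i)) ∧
        ∀ (Γ : Level V) (hΓ : Γ.BelowConjThree), ∀ ω ∈ R.Theta V c i Γ,
          ∃ cf : towerLevel hHD hI (ballQuotientUniformisedDatum_of h₁) h₃ hA Γ hΓ,
            TowerLevel.res hHD hI (ballQuotientUniformisedDatum_of h₁) h₃ hA cf = ω ∧
              (ofLevel hHD hI (ballQuotientUniformisedDatum_of h₁) h₃ hA Γ hΓ cf :
                  (LiuDictionary.ofTower hHD hI h₁ h₃ hA V Char Adm Ω (fun μ => ι₁ ∈ (typeOf μ).1)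
                    (fun μ d => d.IsReflexOfTypeG ι₁ (typeOf μ))).H) ∈
                (LiuDictionary.ofTower hHD hI h₁ h₃ hA V Char Adm Ω (fun μ => ι₁ ∈ (typeOf μ).1)
                  (fun μ d => d.IsReflexOfTypeG ι₁ (typeOf μ))).block μ) :
    ∃ Γ₀ : Level V, ∀ Γ ≤ Γ₀,
      ∃ (M : CMField) (k : c.K →+* M) (σ' : M →+* ℂ), σ'.comp k = c.σ ∧
        R.Theta V c i Γ ⊆ (picardCMUniverse hHD hI h₁ h₃).Uiso Γ M (inflate k (c.Ψ i)) σ' := by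
  obtain ⟨μ, hT, hfam⟩ := hJ4
  exact hsmall_of_tower_at_block hHD hI h₁ h₃ V hR hA R c Char Adm Ω (fun μ => ι₁ ∈ (typeOf μ).1)
    (fun μ d => d.IsReflexOfTypeG ι₁ (typeOf μ)) h418 hgood i
    ⟨μ, self_mem_of_liftTyped (hgood.mem i) hT, fun d hd => isCorner_of_liftTyped h6 hT d (by exact hd), hfam⟩

/-- **… slot clause a TYPE EQUATION `Φ^δ(scalar μ) = Φ^δ(a_i)`** (binder-2 #100 `hsmall_of_tower_at_of_lineType_eq`, one block). [folklore] -/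
theorem hsmall_of_tower_at_block_of_lineType_eq (hR : DeligneMilne1982_Thm_6_20_full) (hA : Arapura2012_Cor_15_4_6)
    (R : (picardCMUniverse hHD hI h₁ h₃).ThetaModel) (c : SeesawCtx L)
    (Char : Type) (Adm : Char → Type) (Ω : (μ : Char) → Adm μ → Type)
    [∀ μ a, AddCommGroup (Ω μ a)] [∀ μ a, Module ℂ (Ω μ a)] [∀ μ a, Module (adelicAlgebra V) (Ω μ a)]
    [∀ μ a, IsScalarTower ℂ (adelicAlgebra V) (Ω μ a)]
    (scalar : Char → L) (hreal : ∀ μ, conjRingHomK L (scalar μ) = scalar μ) (hne : ∀ μ, scalar μ ≠ 0)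
    (h418 : (LiuDictionary.ofTower hHD hI h₁ h₃ hA V Char Adm Ω
        (fun μ => ι₁ ∈ (lineType (scalar μ) (hreal μ) (hne μ)).1)
        (fun μ d => d.IsReflexOfTypeG ι₁ (lineType (scalar μ) (hreal μ) (hne μ)))).Thm418C)
    (hgood : R.GoodCtx ι₁ c) (hrec : SignRecipe.GoodCtx (Model.orientBitι L ι₁) ι₁ c)
    (h6 : Module.finrank ℚ c.K = 6 ∧ IsNormalClosure ℚ c.K L ∧ (Module.finrank ℚ L = 24 ∨ Module.finrank ℚ L = 48))
    (i : Fin 4)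
    (hJS : ∃ μ : Char,
        lineType (scalar μ) (hreal μ) (hne μ) = lineType (c.D.a i) (c.D.a_real i) (c.D.a_ne i) ∧
        ∀ (Γ : Level V) (hΓ : Γ.BelowConjThree), ∀ ω ∈ R.Theta V c i Γ,
          ∃ cf : towerLevel hHD hI (ballQuotientUniformisedDatum_of h₁) h₃ hA Γ hΓ,
            TowerLevel.res hHD hI (ballQuotientUniformisedDatum_of h₁) h₃ hA cf = ω ∧
              (ofLevel hHD hI (ballQuotientUniformisedDatum_of h₁) h₃ hA Γ hΓ cf :
                  (LiuDictionary.ofTower hHD hI h₁ h₃ hA V Char Adm Ω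
                    (fun μ => ι₁ ∈ (lineType (scalar μ) (hreal μ) (hne μ)).1)
                    (fun μ d => d.IsReflexOfTypeG ι₁ (lineType (scalar μ) (hreal μ) (hne μ)))).H) ∈
                (LiuDictionary.ofTower hHD hI h₁ h₃ hA V Char Adm Ω
                  (fun μ => ι₁ ∈ (lineType (scalar μ) (hreal μ) (hne μ)).1)
                  (fun μ d => d.IsReflexOfTypeG ι₁ (lineType (scalar μ) (hreal μ) (hne μ)))).block μ) :
    ∃ Γ₀ : Level V, ∀ Γ ≤ Γ₀,
      ∃ (M : CMField) (k : c.K →+* M) (σ' : M →+* ℂ), σ'.comp k = c.σ ∧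
        R.Theta V c i Γ ⊆ (picardCMUniverse hHD hI h₁ h₃).Uiso Γ M (inflate k (c.Ψ i)) σ' := by
  obtain ⟨μ, hμ, hfam⟩ := hJS
  exact hsmall_of_tower_at_block_of_typeOf hHD hI h₁ h₃ V hR hA R c Char Adm Ω
    (fun μ => lineType (scalar μ) (hreal μ) (hne μ)) h418 hgood h6 i
    ⟨μ, liftTyped_of_lineType_eq scalar hreal hne _ (fun _ => rfl) h6.2.1 hrec hμ, hfam⟩

/-- **… slot clause an ISOMETRY `∃ z ≠ 0, scalar μ = z z̄ · a_i`** (binder-2 #100 `hsmall_of_tower_at_of_isometric`, one block). [folklore] -/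
theorem hsmall_of_tower_at_block_of_isometric (hR : DeligneMilne1982_Thm_6_20_full) (hA : Arapura2012_Cor_15_4_6)
    (R : (picardCMUniverse hHD hI h₁ h₃).ThetaModel) (c : SeesawCtx L)
    (Char : Type) (Adm : Char → Type) (Ω : (μ : Char) → Adm μ → Type)
    [∀ μ a, AddCommGroup (Ω μ a)] [∀ μ a, Module ℂ (Ω μ a)] [∀ μ a, Module (adelicAlgebra V) (Ω μ a)]
    [∀ μ a, IsScalarTower ℂ (adelicAlgebra V) (Ω μ a)]
    (scalar : Char → L) (hreal : ∀ μ, conjRingHomK L (scalar μ) = scalar μ) (hne : ∀ μ, scalar μ ≠ 0)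
    (h418 : (LiuDictionary.ofTower hHD hI h₁ h₃ hA V Char Adm Ω
        (fun μ => ι₁ ∈ (lineType (scalar μ) (hreal μ) (hne μ)).1)
        (fun μ d => d.IsReflexOfTypeG ι₁ (lineType (scalar μ) (hreal μ) (hne μ)))).Thm418C)
    (hgood : R.GoodCtx ι₁ c) (hrec : SignRecipe.GoodCtx (Model.orientBitι L ι₁) ι₁ c)
    (h6 : Module.finrank ℚ c.K = 6 ∧ IsNormalClosure ℚ c.K L ∧ (Module.finrank ℚ L = 24 ∨ Module.finrank ℚ L = 48))
    (i : Fin 4)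
    (hJS : ∃ μ : Char,
        (∃ z : L, z ≠ 0 ∧ scalar μ = z * conjRingHomK L z * c.D.a i) ∧
        ∀ (Γ : Level V) (hΓ : Γ.BelowConjThree), ∀ ω ∈ R.Theta V c i Γ,
          ∃ cf : towerLevel hHD hI (ballQuotientUniformisedDatum_of h₁) h₃ hA Γ hΓ,
            TowerLevel.res hHD hI (ballQuotientUniformisedDatum_of h₁) h₃ hA cf = ω ∧
              (ofLevel hHD hI (ballQuotientUniformisedDatum_of h₁) h₃ hA Γ hΓ cf :
                  (LiuDictionary.ofTower hHD hI h₁ h₃ hA V Char Adm Ω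
                    (fun μ => ι₁ ∈ (lineType (scalar μ) (hreal μ) (hne μ)).1)
                    (fun μ d => d.IsReflexOfTypeG ι₁ (lineType (scalar μ) (hreal μ) (hne μ)))).H) ∈
                (LiuDictionary.ofTower hHD hI h₁ h₃ hA V Char Adm Ω
                  (fun μ => ι₁ ∈ (lineType (scalar μ) (hreal μ) (hne μ)).1)
                  (fun μ d => d.IsReflexOfTypeG ι₁ (lineType (scalar μ) (hreal μ) (hne μ)))).block μ) :
    ∃ Γ₀ : Level V, ∀ Γ ≤ Γ₀,
      ∃ (M : CMField) (k : c.K →+* M) (σ' : M →+* ℂ), σ'.comp k = c.σ ∧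
        R.Theta V c i Γ ⊆ (picardCMUniverse hHD hI h₁ h₃).Uiso Γ M (inflate k (c.Ψ i)) σ' := by
  obtain ⟨μ, ⟨z, hz, hzeq⟩, hfam⟩ := hJS
  exact hsmall_of_tower_at_block_of_lineType_eq hHD hI h₁ h₃ V hR hA R c Char Adm Ω scalar hreal hne h418 hgood hrec h6 i
    ⟨μ, SignRecipe.lineType_eq_of_isometric hz (c.D.a_real i) (c.D.a_ne i) (hreal μ) (hne μ) hzeq, hfam⟩

end Tower

/-! ## §3 Over axioms-1's indexed instance OF RECORD (`liuDictionaryOfWeilFamilyAut`, `GoodChar := IsAutChar`) -/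

section Instance

variable (hHD : exists_isReal_hodgeModel) (hI : hodgePQ_independent_of_hodgeModel)
  (h₁ : BallQuotientUniformised) (h₃ : CMAbelianVarietyRealised) (hA : Arapura2012_Cor_15_4_6)
variable {L : CMField} {ι₁ : (L : Type) →+* ℂ} (V : HermSpace3 L ι₁)
variable {JV : Matrix (Fin 3) (Fin 3) (L : Type)} {TV : Matrix (Fin 3) (Fin 3) ↥(maximalRealSubfield (L : Type))}
  {δ : (L : Type)} {hcδ : IsCMField.complexConj (L : Type) δ = -δ} {hδ : δ ≠ 0} {d : ↥(maximalRealSubfield (L : Type))}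
  {hd : δ * δ = algebraMap _ (L : Type) d} {hV : TV.IsSymm} {hVd : IsUnit TV.det}
  {hJV : JV = TV.map (algebraMap _ (L : Type))}
  (ιV : ↥V.adelicFin →*
    ↥(UnitaryGroup.finAdelic (↥(maximalRealSubfield (L : Type))) (L : Type) (IsCMField.complexConj (L : Type)) 3 JV))
  (I : Type) (line : I → SplitLine JV TV hcδ hδ hd hV hVd hJV)

/-- **E's `hsmall` OVER THE INDEXED INSTANCE OF RECORD FROM ONE BLOCK, slot clause = ISOMETRY** (binder-2 #100
`hsmall_of_weilFamilyAut_at_of_isometric` with `hJS := ∃ j, …` ONE index and `hcite := Thm418C` alone). [folklore] -/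
theorem hsmall_of_weilFamilyAut_at_block_of_isometric (hR : DeligneMilne1982_Thm_6_20_full)
    (R : (picardCMUniverse hHD hI h₁ h₃).ThetaModel) (c : SeesawCtx L)
    (h418 : (liuDictionaryOfWeilFamilyAut hHD hI h₁ h₃ hA V ιV I line).Thm418C)
    (hgood : R.GoodCtx ι₁ c) (hrec : SignRecipe.GoodCtx (Model.orientBitι L ι₁) ι₁ c)
    (h6 : Module.finrank ℚ c.K = 6 ∧ IsNormalClosure ℚ c.K L ∧ (Module.finrank ℚ L = 24 ∨ Module.finrank ℚ L = 48))
    (i : Fin 4)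
    (hJS : ∃ j : I,
        (∃ z : (L : Type), z ≠ 0 ∧ (line j).scalar = z * conjRingHomK L z * c.D.a i) ∧
        ∀ (Γ : Level V) (hΓ : Γ.BelowConjThree), ∀ ω ∈ R.Theta V c i Γ,
          ∃ cf : towerLevel hHD hI (ballQuotientUniformisedDatum_of h₁) h₃ hA Γ hΓ,
            TowerLevel.res hHD hI (ballQuotientUniformisedDatum_of h₁) h₃ hA cf = ω ∧
              (ofLevel hHD hI (ballQuotientUniformisedDatum_of h₁) h₃ hA Γ hΓ cf :
                  (liuDictionaryOfWeilFamilyAut hHD hI h₁ h₃ hA V ιV I line).H) ∈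
                (liuDictionaryOfWeilFamilyAut hHD hI h₁ h₃ hA V ιV I line).block j) :
    ∃ Γ₀ : Level V, ∀ Γ ≤ Γ₀,
      ∃ (M : CMField) (k : c.K →+* M) (σ' : M →+* ℂ), σ'.comp k = c.σ ∧
        R.Theta V c i Γ ⊆ (picardCMUniverse hHD hI h₁ h₃).Uiso Γ M (inflate k (c.Ψ i)) σ' :=
  hsmall_of_tower_at_block_of_isometric hHD hI h₁ h₃ V hR hA R c I (fun j => {χ : (line j).CharW // (line j).IsAutChar χ})
    (fun j a => (line j).Ω ιV a.1) (fun j => (line j).scalar) (fun j => (line j).conj_scalar)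
    (fun j => (line j).scalar_ne_zero) h418 hgood hrec h6 i hJS

end Instance

end HodgeCM.Model

end
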